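import Mathlib
import Literature.MathematicalPhysics.QuantumFieldTheory.Balaban1983to89.B6SectA
import Literature.MathematicalPhysics.QuantumFieldTheory.Balaban1983to89.B6Eq211

/-!
# `Balaban1983to89.B6SectABlockSystem` — T. Bałaban, *Propagators and renormalization transformations for lattice
gauge theories. II*, Commun. Math. Phys. **96** (1984) 223–250 [Balaban1984PropagatorsII] (cell paper B6), Sect. A:
the operators `Q′` (2.7)/(2.14), `Δ = ∂*∂` (2.8), `Δ′_a = Δ + Q′*aQ′` with the form (2.14), and `G′ = Δ′_a⁻¹` BUILT
CONCRETELY on every block system — file 1/2 of the model instance of Sect. A (file 2/2 `…B6Eq217BlockSystem`: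
`(Q′G′²Q′*)⁻¹`, the representation (2.17), (2.12)/(2.13), (2.26)–(2.27) for these operators)

statement-level skeleton of published theorems with citation tags; proofs where landed; nothing here is a claim about the
Yang–Mills mass gap.
PDF held: `paper:balaban1984-cmp96-propagators-rt-ii` (journal page = PDF page + 222); pp. 224–225 [PDF 2–3] read this
session from the ×2 renders `run/shared/lean/pub/pub-balaban/b2b-balaban-ref1/pages/1984-cmp96-propagators-rt-II/…-p002,
p003-x2.png` AS IMAGES (not from the OCR layer).
WHAT IS REPRODUCED: cell `lit-balaban` (HOME `run/shared/lean/pub/lit-balaban/`), Phase-2 proof seat p21 gen 2 (unit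
`lit-balaban-p21-g2`); SKELETON rows `B6.Eq2.13` ((2.13)–(2.14): Δ′_a and its quadratic form), `B6.Eq2.7`/`B6.Eq2.10`
(N(Q′) = ker Q′) and the p. 225 sentence *"G′ = Δ′_a⁻¹ is a well defined, positive operator"* serving rows
`B6.Eq2.17`/`B6.Eq2.12` (file 2/2); owner r03 (`HOME/lit-balaban-r03/ROWS-B6.md` «Phase-2 targets … for the concrete
lattice operators»), referee ref-4.  KIND: model instance — r03's abstract `…B6SectA` (p238845) takes `G′`,
`(Q′G′²Q′*)⁻¹` and (2.11) as NAMED HYPOTHESES; here they are CONSTRUCTED / DISCHARGED on r03's carrier of record for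
(2.11), `…B6Eq211.BlockSystem` (p242700: the η-lattice with sites `ι`, bonds `κ`, the zero set `Λ₀`, the finite family
`β` of pairwise disjoint charted blocks `B^j(y)`, `y ∈ Λ_j`, `j ≥ 1`), under the printed geometric fact (2.4) `Cover S`
(T = Λ₀ ∪ ⋃_{j≥1} B^j(Λ_j)); `BlocksOffZero S` ((2.3): B^j(Λ_j) ⊂ Ω₁ = Λ₀ᶜ) is used in file 2/2.
IMPORTED, not modified: `…B6SectA`, `…B6Eq211`.

WHAT THE PAPER PRINTS (pp. 224–225, verbatim).  (2.7) *"gauge transformations λ : A → A^λ = A − ∂λ such that λ = 0 on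
Λ₀, Q′_jλ = 0 on Λ_j, j = 1, …, k."*; (2.8) *"we choose a minimum of the functional Σ_x η^d|(∂*A^λ)(x)|² =
Σ_x η^d|(∂*A)(x) − (Δλ)(x)|²"*; (2.10) *"N(Q′) = {λ : λ satisfies (2.7)}"*; (2.13)–(2.14) *"λ ∈ N(Q′), λ → Σ_x η^d|f(x)
− (Δλ)(x)|² = Σ_x η^d|f(x) − (Δ′_aλ)(x)|², (2.13) and where Δ′_a = Δ + Q′*aQ′ and the operator Q′*aQ′ is given by the
quadratic form ⟨λ, Q′*aQ′λ⟩ = Σ_{j=0}^k Σ_{y∈Λ_j} a_j(L^jη)^{d−2}|(Q′_jλ)(y)|². (2.14) … and we assume that (Q′₀λ)(x) =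
λ(x), x ∈ Λ₀."*; (2.15) *"⟨ω, Q′λ⟩ = Σ_{j=0}^k Σ_{y∈Λ_j} (L^jη)^d ω(y)(Q′_jλ)(y)"*; p. 225 after (2.17): *"The operator
G′ = Δ′_a⁻¹ is a well defined, positive operator because Δ′_a satisfies the inequality (2.11) for all λ, with min{a_j,
π²} instead of π² and the index j running from 0 to k on the right-hand side."*

WHAT IS BUILT AND PROVED (0 sorry, 0 named facts).  For a block system `S`: `L²(T_η) := EuclideanSpace ℝ ι`,
`L²(𝔅) := EuclideanSpace ℝ (Λ₀ ⊕ β)` (`AvgIdx S`; 𝔅 = Λ₀ ∪ ⋃_{j≥1}Λ_j).  §1 `Qp S` = Q′ VERBATIM (identity on Λ₀,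
block means `L^{−jd}Σ_{x∈B^j(y)}`), `Qp_eq_zero_iff` (ker Q′ = r03's `InGaugeSpace` = N(Q′) of (2.7)/(2.10)), `D S` = ∂,
`lap S` = Δ = ∂*∂, `form_eq` (r03's `BlockSystem.form` = η^d⟨λ,Δλ⟩), `aOp` = the weight a, `Qps S` = Q′* (the ℓ²
adjoint), `deltaP S w` = Δ′_a := `B6SectA.deltaPrime` AT THESE OPERATORS.  §2 **(2.14)** `inner_deltaP_self`, and WITH
THE PRINTED WEIGHTS AND NORMALISATION `form214_printed`.  §3 *"Δ is positive on N(Q′), hence invertible"*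
(`lap_injOn_gauge` ⇐ r03's `BlockSystem.eq_zero_of_form_eq_zero`), Δ′_a positive definite (`inner_deltaP_self_pos`),
**G′ CONSTRUCTED** (`green`: two-sided inverse `green_deltaP`/`deltaP_green`, symmetric `green_symm`, positive
`green_pos`).  DICTIONARY (recorded, not a printed sentence): the printed pairings carry the weights η^d on T_η and
(L^jη)^d on 𝔅 ((2.13)/(2.15)); this file uses the unweighted ℓ² products — the common factor η^d drops out of every
operator on L²(T_η) and the printed weights a_j(L^jη)^{d−2} become `wPrinted` (`form214_printed` displays (2.14)
verbatim); the printed weighted adjoint of Q′ and the invariance of (2.17) under this choice are in file 2/2.  Any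
positive weight family `w` is admitted (the paper: a_{j+1} = aa_j/(aL⁻² + a_j), a₁ = a > 0).
NOT HERE: the vector-field side of Sect. A ((2.18)–(2.23), (2.31)–(2.35): `BlockSystem` has no bond fields /
plaquettes), any bound (Props 2.2 ff.), the nested geometry (2.1)–(2.2) beyond `Cover`/`BlocksOffZero`.
-/


namespace Literature.MathematicalPhysics.QuantumFieldTheory.Balaban1983to89.B6SectABlockSystem

open Finset
open scoped BigOperators InnerProductSpace
open B6Eq211 (BlockSystem)

noncomputable section

variable {ι κ β : Type*}

/-! ## §1. The carriers and the operators `Q′`, `∂`, `Δ`, `a`, `Q′*`, `Δ′_a` of a block system -/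

section Operators

variable (S : BlockSystem ι κ β)

/-- (2.4): the blocks `B^j(Λ_j)`, `j ≥ 1`, and `Λ₀` cover `T` (*"T = ⋃_{j=0}^k B^j(Λ_j), where B⁰(Λ₀) = Λ₀"*) — the
hypothesis of r03's `BlockSystem.eq_zero_of_form_eq_zero`. [cite: Balaban1984PropagatorsII, (2.4) p.224] -/
def Cover : Prop := ∀ x, x ∈ S.zeroSet ∨ ∃ b y, S.chart b y = x

/-- (2.3)–(2.4): the blocks lie in `Ω₁ = Λ₀ᶜ` (*"Λ₀ = Ω₁ᶜ"*, *"Ω₁ = ⋃_{j=1}^k B^j(Λ_j)"*). [cite: Balaban1984PropagatorsII, (2.3)–(2.4) p.224] -/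
def BlocksOffZero : Prop := ∀ b y, S.chart b y ∉ S.zeroSet

/-- The index set of the multi-scale averages: `𝔅 = Λ₀ ∪ ⋃_{j≥1}Λ_j` (a point of `Λ₀`, where `Q′₀ = id`, or a block
`B^j(y)`). [cite: Balaban1984PropagatorsII, (2.14) p.225] -/
abbrev AvgIdx : Type _ := ↥S.zeroSet ⊕ β

/-- The number of sites `(L^j)^d = (side b + 1)^d` of the block `b = B^j(y)`. [cite: Balaban1984PropagatorsII, (2.14) p.225] -/
def vol (b : β) : ℝ := ((S.side b : ℝ) + 1) ^ S.d

/-- `(L^j)^d > 0`. [cite: Balaban1984PropagatorsII, (2.14) p.225] -/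
theorem vol_pos (b : β) : 0 < vol S b := by unfold vol; positivity

/-- `|{0,…,side b}^d| = vol b`. [cite: Balaban1984PropagatorsII, (2.14) p.225] -/
theorem card_cube (b : β) : (Fintype.card (Fin S.d → Fin (S.side b + 1)) : ℝ) = vol S b := by
  rw [Fintype.card_fun, Fintype.card_fin, Fintype.card_fin, vol]; push_cast; ring

/-- `Q′` on bare functions: `(Q′λ)(x) = λ(x)` on `Λ₀`, `(Q′_jλ)(y) = L^{−jd}Σ_{x∈B^j(y)}λ(x)` on the blocks.
[cite: Balaban1984PropagatorsII, (2.7) p.224, (2.14) p.225] -/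
def qFun : (ι → ℝ) →ₗ[ℝ] (AvgIdx S → ℝ) where
  toFun lam := Sum.elim (fun x : ↥S.zeroSet => lam x) (fun b => (vol S b)⁻¹ * ∑ y, lam (S.chart b y))
  map_add' f g := by
    funext i; cases i with
    | inl x => simp
    | inr b => simp only [Sum.elim_inr, Pi.add_apply, Finset.sum_add_distrib, mul_add]
  map_smul' r f := by
    funext i; cases i with
    | inl x => simp
    | inr b => simp only [Sum.elim_inr, Pi.smul_apply, smul_eq_mul, RingHom.id_apply, ← Finset.mul_sum]; ring

/-- **`Q′ : L²(T_η) → L²(𝔅)`**, the multi-scale averaging operator of (2.7)/(2.14). [cite: Balaban1984PropagatorsII, (2.7) p.224, (2.14) p.225] -/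
def Qp : EuclideanSpace ℝ ι →ₗ[ℝ] EuclideanSpace ℝ (AvgIdx S) :=
  (WithLp.linearEquiv 2 ℝ (AvgIdx S → ℝ)).symm.toLinearMap ∘ₗ qFun S ∘ₗ (WithLp.linearEquiv 2 ℝ (ι → ℝ)).toLinearMap

/-- `(Q′λ)(x) = λ(x)` on `Λ₀`. [cite: Balaban1984PropagatorsII, (2.14) p.225] -/
@[simp] theorem Qp_apply_inl (f : EuclideanSpace ℝ ι) (x : ↥S.zeroSet) : Qp S f (Sum.inl x) = f x := rfl

/-- `(Q′_jλ)(y) = (L^j)^{−d}Σ_{x∈B^j(y)}λ(x)` on the block `b = B^j(y)`. [cite: Balaban1984PropagatorsII, (2.14) p.225] -/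
@[simp] theorem Qp_apply_inr (f : EuclideanSpace ℝ ι) (b : β) :
    Qp S f (Sum.inr b) = (vol S b)⁻¹ * ∑ y, f (S.chart b y) := rfl

/-- **N(Q′) = ker Q′:** `Q′λ = 0` iff *"λ = 0 on Λ₀, Q′_jλ = 0 on Λ_j"* (2.7), i.e. iff `λ` lies in r03's
`BlockSystem.InGaugeSpace`. [cite: Balaban1984PropagatorsII, (2.7) p.224, (2.10) p.225] -/
theorem Qp_eq_zero_iff (f : EuclideanSpace ℝ ι) : Qp S f = 0 ↔ S.InGaugeSpace (WithLp.ofLp f) := by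
  constructor
  · intro h
    refine ⟨fun x hx => ?_, fun b => ?_⟩
    · simpa using congrArg (fun g : EuclideanSpace ℝ (AvgIdx S) => g (Sum.inl ⟨x, hx⟩)) h
    · have := congrArg (fun g : EuclideanSpace ℝ (AvgIdx S) => g (Sum.inr b)) h
      simp only [Qp_apply_inr, PiLp.zero_apply, mul_eq_zero, inv_eq_zero] at this
      exact this.resolve_left (vol_pos S b).ne'
  · rintro ⟨h0, hb⟩
    apply PiLp.ext
    intro i
    cases i with
    | inl x => simpa using h0 x x.2
    | inr b => rw [Qp_apply_inr, PiLp.zero_apply, hb b, mul_zero]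

/-- `λ ∈ B6SectA.gaugeSpace (Qp S)` (= ker Q′) unfolded. [cite: Balaban1984PropagatorsII, (2.10) p.225] -/
theorem mem_gaugeSpace_iff_eq (f : EuclideanSpace ℝ ι) : f ∈ B6SectA.gaugeSpace (Qp S) ↔ Qp S f = 0 := Iff.rfl

/-- `B6SectA.gaugeSpace (Qp S)` IS r03's `N(Q′)`. [cite: Balaban1984PropagatorsII, (2.10) p.225] -/
theorem mem_gaugeSpace_iff (f : EuclideanSpace ℝ ι) :
    f ∈ B6SectA.gaugeSpace (Qp S) ↔ S.InGaugeSpace (WithLp.ofLp f) := by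
  rw [mem_gaugeSpace_iff_eq, Qp_eq_zero_iff]

/-- `∂` on bare functions: `(∂λ)(b) = η⁻¹(λ(b₊) − λ(b₋))`. [cite: Balaban1984PropagatorsII, (2.8) p.224] -/
def dFun : (ι → ℝ) →ₗ[ℝ] (κ → ℝ) where
  toFun lam k := S.η⁻¹ * (lam (S.tgt k) - lam (S.src k))
  map_add' f g := by funext k; simp only [Pi.add_apply]; ring
  map_smul' r f := by funext k; simp only [Pi.smul_apply, smul_eq_mul, RingHom.id_apply]; ring

/-- **`∂ : L²(T_η) → L²(bonds)`**, the lattice gradient of (2.8). [cite: Balaban1984PropagatorsII, (2.8) p.224] -/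
def D : EuclideanSpace ℝ ι →ₗ[ℝ] EuclideanSpace ℝ κ :=
  (WithLp.linearEquiv 2 ℝ (κ → ℝ)).symm.toLinearMap ∘ₗ dFun S ∘ₗ (WithLp.linearEquiv 2 ℝ (ι → ℝ)).toLinearMap

/-- `(∂λ)(b) = η⁻¹(λ(b₊) − λ(b₋))`. [cite: Balaban1984PropagatorsII, (2.8) p.224] -/
@[simp] theorem D_apply (f : EuclideanSpace ℝ ι) (k : κ) : D S f k = S.η⁻¹ * (f (S.tgt k) - f (S.src k)) := rfl

/-- The weight `a` on `L²(𝔅)`: multiplication by `w` (printed choice `wPrinted`; any positive family admitted).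
[cite: Balaban1984PropagatorsII, (2.14) p.225] -/
def aOp (w : AvgIdx S → ℝ) : EuclideanSpace ℝ (AvgIdx S) →ₗ[ℝ] EuclideanSpace ℝ (AvgIdx S) where
  toFun φ := WithLp.toLp 2 (fun i => w i * φ i)
  map_add' φ ψ := by apply PiLp.ext; intro i; simp only [PiLp.add_apply, mul_add]
  map_smul' r φ := by apply PiLp.ext; intro i; simp only [PiLp.smul_apply, smul_eq_mul, RingHom.id_apply]; ring

/-- `(aφ)(i) = w_i φ(i)`. [cite: Balaban1984PropagatorsII, (2.14) p.225] -/
@[simp] theorem aOp_apply (w : AvgIdx S → ℝ) (φ : EuclideanSpace ℝ (AvgIdx S)) (i : AvgIdx S) :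
    aOp S w φ i = w i * φ i := rfl

/-- The printed weights of (2.14) in the ℓ² normalisation: `a₀η^{d−2}/η^d = a₀/η²` on `Λ₀`,
`a_j(L^jη)^{d−2}/η^d = a_j(L^j)^d/(L^jη)²` on `B^j(y)` (cf. `form214_printed`). [cite: Balaban1984PropagatorsII, (2.14) p.225] -/
def wPrinted (a0 : ℝ) (ab : β → ℝ) : AvgIdx S → ℝ :=
  Sum.elim (fun _ => a0 / S.η ^ 2) (fun b => ab b * (vol S b / (((S.side b : ℝ) + 1) * S.η) ^ 2))

/-- The printed weights are positive for `a₀, a_j > 0` (print: `a_{j+1} = aa_j/(aL⁻² + a_j)`, `a₁ = a > 0`).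
[cite: Balaban1984PropagatorsII, (2.14) p.225] -/
theorem wPrinted_pos {a0 : ℝ} {ab : β → ℝ} (ha0 : 0 < a0) (hab : ∀ b, 0 < ab b) (i : AvgIdx S) :
    0 < wPrinted S a0 ab i := by
  have hη := S.η_pos
  cases i with
  | inl x => simp only [wPrinted, Sum.elim_inl]; positivity
  | inr b => have := vol_pos S b; have := hab b; simp only [wPrinted, Sum.elim_inr]; positivity

variable [Fintype ι] [Fintype β] [DecidablePred (· ∈ S.zeroSet)]

/-- `a` is symmetric. [cite: Balaban1984PropagatorsII, (2.14) p.225] -/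
theorem aOp_symm (w : AvgIdx S → ℝ) (φ ψ : EuclideanSpace ℝ (AvgIdx S)) :
    ⟪aOp S w φ, ψ⟫_ℝ = ⟪φ, aOp S w ψ⟫_ℝ := by
  rw [PiLp.inner_apply, PiLp.inner_apply]
  refine Finset.sum_congr rfl fun i _ => ?_
  simp only [aOp_apply, Real.inner_apply]; ring

/-- `⟨φ, aφ⟩ = Σ_i w_i|φ(i)|²`. [cite: Balaban1984PropagatorsII, (2.14) p.225] -/
theorem inner_aOp_self (w : AvgIdx S → ℝ) (φ : EuclideanSpace ℝ (AvgIdx S)) :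
    ⟪φ, aOp S w φ⟫_ℝ = ∑ i, w i * φ i ^ 2 := by
  rw [PiLp.inner_apply]
  refine Finset.sum_congr rfl fun i _ => ?_
  simp only [aOp_apply, Real.inner_apply]; ring

/-- **`Q′*`**, the adjoint of `Q′` (for the ℓ² products; the adjoint for the printed weighted pairings is `Qps ∘ volOp`,
file 2/2). [cite: Balaban1984PropagatorsII, (2.14)–(2.15) p.225] -/
def Qps : EuclideanSpace ℝ (AvgIdx S) →ₗ[ℝ] EuclideanSpace ℝ ι := LinearMap.adjoint (Qp S)

/-- `⟨Q′*ω, λ⟩ = ⟨ω, Q′λ⟩`. [cite: Balaban1984PropagatorsII, (2.15) p.225] -/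
theorem inner_Qps_left (ω : EuclideanSpace ℝ (AvgIdx S)) (f : EuclideanSpace ℝ ι) :
    ⟪Qps S ω, f⟫_ℝ = ⟪ω, Qp S f⟫_ℝ := LinearMap.adjoint_inner_left _ _ _

/-- `⟨λ, Q′*ω⟩ = ⟨Q′λ, ω⟩`. [cite: Balaban1984PropagatorsII, (2.15) p.225] -/
theorem inner_Qps_right (f : EuclideanSpace ℝ ι) (ω : EuclideanSpace ℝ (AvgIdx S)) :
    ⟪f, Qps S ω⟫_ℝ = ⟪Qp S f, ω⟫_ℝ := LinearMap.adjoint_inner_right _ _ _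

variable [Fintype κ]

/-- **`Δ = ∂*∂`** on `L²(T_η)` (`∂*` = the ℓ²-adjoint of `∂`). [cite: Balaban1984PropagatorsII, (2.8) p.224, (2.13) p.225] -/
def lap : EuclideanSpace ℝ ι →ₗ[ℝ] EuclideanSpace ℝ ι := LinearMap.adjoint (D S) ∘ₗ D S

omit [Fintype β] [DecidablePred (· ∈ S.zeroSet)] in
/-- `⟨f, Δg⟩ = ⟨∂f, ∂g⟩`. [cite: Balaban1984PropagatorsII, (2.8) p.224] -/
theorem inner_lap (f g : EuclideanSpace ℝ ι) : ⟪f, lap S g⟫_ℝ = ⟪D S f, D S g⟫_ℝ := by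
  rw [lap, LinearMap.comp_apply, LinearMap.adjoint_inner_right]

omit [Fintype β] [DecidablePred (· ∈ S.zeroSet)] in
/-- `Δ` is symmetric. [cite: Balaban1984PropagatorsII, (2.8) p.224] -/
theorem lap_symm (f g : EuclideanSpace ℝ ι) : ⟪lap S f, g⟫_ℝ = ⟪f, lap S g⟫_ℝ := by
  rw [real_inner_comm, inner_lap, inner_lap, real_inner_comm]

omit [Fintype β] [DecidablePred (· ∈ S.zeroSet)] in
/-- `⟨λ, Δλ⟩ = ‖∂λ‖² = Σ_b η⁻²|λ(b₊) − λ(b₋)|²` (ℓ² normalisation). [cite: Balaban1984PropagatorsII, (2.8) p.224, (2.11) p.225] -/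
theorem inner_lap_self (f : EuclideanSpace ℝ ι) :
    ⟪f, lap S f⟫_ℝ = ∑ k, (S.η⁻¹ * (f (S.tgt k) - f (S.src k))) ^ 2 := by
  rw [inner_lap, real_inner_self_eq_norm_sq, PiLp.norm_sq_eq_of_L2]
  refine Finset.sum_congr rfl fun k _ => ?_
  rw [D_apply, Real.norm_eq_abs, sq_abs]

omit [Fintype β] [DecidablePred (· ∈ S.zeroSet)] in
/-- `⟨λ, Δλ⟩ ≥ 0`. [cite: Balaban1984PropagatorsII, (2.11) p.225] -/
theorem inner_lap_self_nonneg (f : EuclideanSpace ℝ ι) : 0 ≤ ⟪f, lap S f⟫_ℝ := by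
  rw [inner_lap]; exact real_inner_self_nonneg

omit [Fintype β] [DecidablePred (· ∈ S.zeroSet)] in
/-- r03's `BlockSystem.form λ = Σ_b η^{d−2}|λ(b₊) − λ(b₋)|²` (⟨λ,Δλ⟩ of (2.11), printed normalisation) is `η^d⟨λ, Δλ⟩_{ℓ²}`.
[cite: Balaban1984PropagatorsII, (2.11) p.225] -/
theorem form_eq (f : EuclideanSpace ℝ ι) : S.form (WithLp.ofLp f) = S.η ^ S.d * ⟪f, lap S f⟫_ℝ := by
  rw [inner_lap_self, BlockSystem.form, Finset.mul_sum]
  refine Finset.sum_congr rfl fun k _ => ?_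
  rw [div_eq_mul_inv, mul_pow, inv_pow]; ring

/-- **`Δ′_a = Δ + Q′*aQ′`** (2.13) for the block-system operators := `B6SectA.deltaPrime (lap S) (Qp S) (Qps S) (aOp S w)`.
[cite: Balaban1984PropagatorsII, (2.13)–(2.14) p.225] -/
abbrev deltaP (w : AvgIdx S → ℝ) : EuclideanSpace ℝ ι →ₗ[ℝ] EuclideanSpace ℝ ι :=
  B6SectA.deltaPrime (lap S) (Qp S) (Qps S) (aOp S w)

/-- `Δ′_aλ = Δλ + Q′*(a(Q′λ))`. [cite: Balaban1984PropagatorsII, (2.13) p.225] -/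
theorem deltaP_apply (w : AvgIdx S → ℝ) (f : EuclideanSpace ℝ ι) :
    deltaP S w f = lap S f + Qps S (aOp S w (Qp S f)) := rfl

end Operators

/-! ## §2. The quadratic form (2.14) -/

section Forms

variable (S : BlockSystem ι κ β) [Fintype ι] [Fintype β] [DecidablePred (· ∈ S.zeroSet)] [Fintype κ]

/-- **(2.14):** `⟨λ, Δ′_aλ⟩ = ⟨λ, Δλ⟩ + ⟨Q′λ, aQ′λ⟩ = ⟨λ, Δλ⟩ + Σ_i w_i|(Q′λ)(i)|²` (*"the operator Q′*aQ′ is given by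
the quadratic form …"*; ℓ² normalisation, printed weights in `form214_printed`). [cite: Balaban1984PropagatorsII, (2.14) p.225] -/
theorem inner_deltaP_self (w : AvgIdx S → ℝ) (f : EuclideanSpace ℝ ι) :
    ⟪f, deltaP S w f⟫_ℝ = ⟪f, lap S f⟫_ℝ + ∑ i, w i * Qp S f i ^ 2 := by
  rw [deltaP_apply, inner_add_right, inner_Qps_right, ← inner_aOp_self]

/-- **(2.13)–(2.14) WITH THE PRINTED WEIGHTS AND NORMALISATION:** for `w = wPrinted a₀ a`,
`η^d⟨λ, Δ′_aλ⟩_{ℓ²} = Σ_b η^{d−2}|λ(b₊) − λ(b₋)|² + Σ_{y∈Λ₀} a₀η^{d−2}|λ(y)|² + Σ_{B^j(y)} a_j(L^jη)^{d−2}|(Q′_jλ)(y)|²`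
(`η^{d−2}`, `(L^jη)^{d−2}` written `η^d/η²`, `(L^jη)^d/(L^jη)²`; the first sum is r03's `BlockSystem.form` = ⟨λ,Δλ⟩ of
(2.11)). [cite: Balaban1984PropagatorsII, (2.13)–(2.14) p.225] -/
theorem form214_printed (a0 : ℝ) (ab : β → ℝ) (f : EuclideanSpace ℝ ι) :
    S.η ^ S.d * ⟪f, deltaP S (wPrinted S a0 ab) f⟫_ℝ =
      S.form (WithLp.ofLp f) + ∑ x : ↥S.zeroSet, a0 * (S.η ^ S.d / S.η ^ 2) * f x ^ 2 +
        ∑ b, ab b * ((((S.side b : ℝ) + 1) * S.η) ^ S.d / (((S.side b : ℝ) + 1) * S.η) ^ 2) *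
          ((vol S b)⁻¹ * ∑ y, f (S.chart b y)) ^ 2 := by
  rw [inner_deltaP_self, mul_add, ← form_eq, Fintype.sum_sum_type, mul_add, Finset.mul_sum, Finset.mul_sum,
    ← add_assoc]
  congr 1
  · congr 1
    refine Finset.sum_congr rfl fun x _ => ?_
    simp only [wPrinted, Sum.elim_inl, Qp_apply_inl, div_eq_mul_inv]; ring
  · refine Finset.sum_congr rfl fun b _ => ?_
    simp only [wPrinted, Sum.elim_inr, Qp_apply_inr, div_eq_mul_inv, mul_pow, vol]; ring

/-- `Δ′_a` is symmetric. [cite: Balaban1984PropagatorsII, (2.13) p.225] -/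
theorem deltaP_symm (w : AvgIdx S → ℝ) (f g : EuclideanSpace ℝ ι) :
    ⟪deltaP S w f, g⟫_ℝ = ⟪f, deltaP S w g⟫_ℝ := by
  rw [deltaP_apply, deltaP_apply, inner_add_left, inner_add_right, lap_symm, inner_Qps_left, inner_Qps_right,
    aOp_symm]

/-- `⟨λ, Δ′_aλ⟩ ≥ 0` for positive weights. [cite: Balaban1984PropagatorsII, (2.14) p.225] -/
theorem inner_deltaP_self_nonneg {w : AvgIdx S → ℝ} (hw : ∀ i, 0 < w i) (f : EuclideanSpace ℝ ι) :
    0 ≤ ⟪f, deltaP S w f⟫_ℝ := by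
  rw [inner_deltaP_self]
  exact add_nonneg (inner_lap_self_nonneg S f) (Finset.sum_nonneg fun i _ => mul_nonneg (hw i).le (sq_nonneg _))

end Forms

/-! ## §3. *"Δ is positive on N(Q′), hence invertible"*; `Δ′_a > 0`; `G′ = Δ′_a⁻¹` constructed -/

section Green

variable (S : BlockSystem ι κ β) [Fintype ι] [Fintype β] [DecidablePred (· ∈ S.zeroSet)] [Fintype κ]
  [DecidableEq κ]

omit [DecidablePred (· ∈ S.zeroSet)] in
/-- **p. 225: *"the Laplace operator Δ is positive on the subspace N(Q′), hence it is invertible on this subspace"*** on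
every covering block system: `λ ∈ N(Q′)`, `Δλ = 0` force `λ = 0` (r03's (2.11) theorem
`BlockSystem.eq_zero_of_form_eq_zero`; = hypothesis `hinj` of `B6SectA.orbitMinimiser_unique`). [cite: Balaban1984PropagatorsII, (2.11) p.225] -/
theorem lap_injOn_gauge (hcover : Cover S) : ∀ n ∈ B6SectA.gaugeSpace (Qp S), lap S n = 0 → n = 0 := by
  intro n hn h0
  have hform : S.form (WithLp.ofLp n) = 0 := by rw [form_eq, h0, inner_zero_right, mul_zero]
  exact (WithLp.ofLp_eq_zero 2).1
    (S.eq_zero_of_form_eq_zero hcover (WithLp.ofLp n) ((mem_gaugeSpace_iff S n).1 hn) hform)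

/-- **`Δ′_a` is positive definite** (*"Δ′_a satisfies the inequality (2.11) for all λ, with min{a_j, π²} instead of π²
and the index j running from 0 to k"*, qualitative content): for positive weights on a covering block system
`⟨λ, Δ′_aλ⟩ = 0` forces `λ = 0`. [cite: Balaban1984PropagatorsII, p.225 after (2.17)] -/
theorem eq_zero_of_inner_deltaP_self_eq_zero {w : AvgIdx S → ℝ} (hw : ∀ i, 0 < w i) (hcover : Cover S)
    (f : EuclideanSpace ℝ ι) (h0 : ⟪f, deltaP S w f⟫_ℝ = 0) : f = 0 := by
  rw [inner_deltaP_self] at h0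
  have h1 := inner_lap_self_nonneg S f
  have h2 : ∀ i, 0 ≤ w i * Qp S f i ^ 2 := fun i => mul_nonneg (hw i).le (sq_nonneg _)
  have h3 : ∑ i, w i * Qp S f i ^ 2 = 0 := by
    have := Finset.sum_nonneg fun i (_ : i ∈ (univ : Finset (AvgIdx S))) => h2 i
    linarith
  have hQ : Qp S f = 0 := by
    refine PiLp.ext fun i => ?_
    have hi := (Finset.sum_eq_zero_iff_of_nonneg fun i _ => h2 i).1 h3 i (Finset.mem_univ i)
    rw [PiLp.zero_apply]
    exact (pow_eq_zero_iff two_ne_zero).mp ((mul_eq_zero.mp hi).resolve_left (hw i).ne')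
  have hD : D S f = 0 := by
    have hlap0 : ⟪f, lap S f⟫_ℝ = 0 := by linarith
    rw [inner_lap, real_inner_self_eq_norm_sq] at hlap0
    exact norm_eq_zero.mp ((pow_eq_zero_iff two_ne_zero).mp hlap0)
  exact lap_injOn_gauge S hcover f hQ (by rw [lap, LinearMap.comp_apply, hD, map_zero])

/-- `⟨λ, Δ′_aλ⟩ > 0` for `λ ≠ 0`. [cite: Balaban1984PropagatorsII, p.225 after (2.17)] -/
theorem inner_deltaP_self_pos {w : AvgIdx S → ℝ} (hw : ∀ i, 0 < w i) (hcover : Cover S) {f : EuclideanSpace ℝ ι}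
    (hf : f ≠ 0) : 0 < ⟪f, deltaP S w f⟫_ℝ :=
  lt_of_le_of_ne (inner_deltaP_self_nonneg S hw f)
    fun h => hf (eq_zero_of_inner_deltaP_self_eq_zero S hw hcover f h.symm)

/-- `Δ′_a` is injective (hence, `L²(T_η)` being finite-dimensional, invertible). [cite: Balaban1984PropagatorsII, p.225 after (2.17)] -/
theorem deltaP_injective {w : AvgIdx S → ℝ} (hw : ∀ i, 0 < w i) (hcover : Cover S) :
    Function.Injective (deltaP S w) := by
  intro f g hfg
  have h0 : deltaP S w (f - g) = 0 := by rw [map_sub, hfg, sub_self]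
  exact sub_eq_zero.mp
    (eq_zero_of_inner_deltaP_self_eq_zero S hw hcover (f - g) (by rw [h0, inner_zero_right]))

/-- **`G′ := Δ′_a⁻¹`** (*"The operator G′ = Δ′_a⁻¹ is a well defined, positive operator"*), CONSTRUCTED as the inverse
of the injective endomorphism `Δ′_a` of the finite-dimensional `L²(T_η)`. [cite: Balaban1984PropagatorsII, (2.17) p.225] -/
def green {w : AvgIdx S → ℝ} (hw : ∀ i, 0 < w i) (hcover : Cover S) :
    EuclideanSpace ℝ ι →ₗ[ℝ] EuclideanSpace ℝ ι :=
  (LinearEquiv.ofInjectiveEndo (deltaP S w) (deltaP_injective S hw hcover)).symm.toLinearMap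

/-- `G′Δ′_a = I`. [cite: Balaban1984PropagatorsII, (2.17) p.225] -/
theorem green_deltaP {w : AvgIdx S → ℝ} (hw : ∀ i, 0 < w i) (hcover : Cover S) (f : EuclideanSpace ℝ ι) :
    green S hw hcover (deltaP S w f) = f :=
  (LinearEquiv.ofInjectiveEndo _ (deltaP_injective S hw hcover)).symm_apply_apply f

/-- `Δ′_aG′ = I`. [cite: Balaban1984PropagatorsII, (2.17) p.225] -/
theorem deltaP_green {w : AvgIdx S → ℝ} (hw : ∀ i, 0 < w i) (hcover : Cover S) (f : EuclideanSpace ℝ ι) :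
    deltaP S w (green S hw hcover f) = f :=
  (LinearEquiv.ofInjectiveEndo _ (deltaP_injective S hw hcover)).apply_symm_apply f

/-- `G′ ∘ Δ′_a = id` (hypothesis `hr` of `B6SectA.starProjection_eq_repr217`). [cite: Balaban1984PropagatorsII, (2.17) p.225] -/
theorem green_comp_deltaP {w : AvgIdx S → ℝ} (hw : ∀ i, 0 < w i) (hcover : Cover S) :
    green S hw hcover ∘ₗ deltaP S w = LinearMap.id :=
  LinearMap.ext (green_deltaP S hw hcover)

/-- `Δ′_a ∘ G′ = id` (hypothesis `hl` of `B6SectA.starProjection_eq_repr217`). [cite: Balaban1984PropagatorsII, (2.17) p.225] -/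
theorem deltaP_comp_green {w : AvgIdx S → ℝ} (hw : ∀ i, 0 < w i) (hcover : Cover S) :
    deltaP S w ∘ₗ green S hw hcover = LinearMap.id :=
  LinearMap.ext (deltaP_green S hw hcover)

/-- `G′` is symmetric (inverse of the symmetric `Δ′_a`; hypothesis `hsym` of `B6SectA.starProjection_eq_repr217`).
[cite: Balaban1984PropagatorsII, (2.17) p.225] -/
theorem green_symm {w : AvgIdx S → ℝ} (hw : ∀ i, 0 < w i) (hcover : Cover S) (x y : EuclideanSpace ℝ ι) :
    ⟪green S hw hcover x, y⟫_ℝ = ⟪x, green S hw hcover y⟫_ℝ := by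
  conv_lhs => rw [← deltaP_green S hw hcover y]
  conv_rhs => rw [← deltaP_green S hw hcover x]
  exact (deltaP_symm S w _ _).symm

/-- *"G′ = Δ′_a⁻¹ is a … positive operator"*: `⟨f, G′f⟩ > 0` for `f ≠ 0`. [cite: Balaban1984PropagatorsII, p.225 after (2.17)] -/
theorem green_pos {w : AvgIdx S → ℝ} (hw : ∀ i, 0 < w i) (hcover : Cover S) {f : EuclideanSpace ℝ ι} (hf : f ≠ 0) :
    0 < ⟪f, green S hw hcover f⟫_ℝ := by
  have hg : green S hw hcover f ≠ 0 := fun h => hf (by rw [← deltaP_green S hw hcover f, h, map_zero])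
  have := inner_deltaP_self_pos S hw hcover hg
  rwa [deltaP_green, real_inner_comm] at this

end Green

end

end Literature.MathematicalPhysics.QuantumFieldTheory.Balaban1983to89.B6SectABlockSystem
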